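import Summits.QuantumFields.BalabanUV.T4Continuum.Spine.NE1p.DressedSmallFieldComponentCount

/-!
# T⁴ programme, spine estimate NE1′ (node O3b/H2) — THE TABLE-BLIND COUNTS OF THE SECOND, THIRD AND FOURTH RESUMMATION
# STEPS AS STATEMENTS WITHOUT A TABLE (PART 1 of 2; PART 2 `DressedSmallFieldLabelCountsMu` = road P1's source-pencil twins)

Cell `pub-balaban`, sub-cell `t4`, BINDER-OWNERS row NE1′; owner lineage t4-ne1p-p1 (PROVER seat P1, «RG-trajectory comparison …
μ-uniformity through the printed small-field bounds»), generation 30; ADDITIVE — imports the owner's N0w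
`Spine/NE1p/DressedSmallFieldComponentCount` (p234287) ONLY (→ N0v `DressedSmallFieldOuterCount` p233273 → N0u
`DressedSmallFieldInnerCount` p232292 → N0t `DressedSmallFieldFamilyAmplitude` p231180 → N0s `DressedSmallFieldFamilyCount` p230233 →
N0r → N0q → N0p; the b13 sub-cell's `B13FamilySum` ∕ `B13` lie in that cone); THEOREMS ONLY (0 def, 0 `def … : Prop`, 0 cite);
nothing of N0s ∕ N0t ∕ N0u ∕ N0v ∕ N0w ∕ row NE5's ∕ the substrate's ∕ b13's modules is restated — their declarations are used BY NAME.

WHY THIS FILE (road P1's own question: through WHICH letter does the source `μ` ∕ the dressed table radius enter the small-field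
bracket's (B3), at EVERY index of print's four resummation steps?).  N0s split (B3)'s letter budget into AMPLITUDE × TABLE-BLIND
COUNT and proved the 𝐃-step count; N0u (labels `⟨Z₀∖Y₀, 𝐃, P⟩`), N0v (labels `⟨Z∖Z′₀, {Z′_i}, inner data⟩`) and N0w (inner data =
anchored components) each SUPPLIED the count `hCount` of N0s's END — but INSIDE the proof of their table-pencil END, so that «the
count never sees the table» was so far a property of three PROOFS.  Here the three counts are CUT OUT as named theorems whose
SIGNATURES contain no carrier, no potential frame, no core, no operator point, no table `h₀`, no direction `w`∕`v`, no source and no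
cutoff — only the two domain geometries, the reading maps and the rates:
* §1 `count_innerLabels_geometry` — the SECOND step ((2.27)∕(2.29)∕(2.31)–(2.34) KIND) from the (2.11)-geometry `Gk` one scale
  down, `foot`∕`hmono`, `bondsOf`∕`hb₀`, the (2.27)∘(2.32)-KIND link `hlink`, the rate bookkeeping `0 ≤ Rkp ≤ R − c₁u`
  (`u := e^{Rc₃₂}·s·e^{b₀t}`) and the label shape `hadm`:
  `Σ_{l ∈ terms Z} (Π_{Y∈𝐃} α₆e^{−δκ d_k Y}·e^{−R(d_k Y+5)})·(s²t)^{#P} ≤ e^{−Rkp·d(Z)}` — N0u's `innerCount_le_decay` BY NAME;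
* §2 `count_outerLabels_geometry` — the THIRD and FOURTH steps ((2.35)–(2.37)∕(2.39) KIND) on the step geometry `G` itself, member
  data `J`∕`n`∕`hmember`, the (2.27)∘(2.37)-KIND link `hlink`, `0 ≤ Rkp ≤ R − c₁u` (`u := v·e^{Rc′}`), `hadm`:
  `Σ_{l ∈ terms Z} v^{#W′}·Π_{Z′∈F} n Z′ (p Z′) ≤ e^{−Rkp·d(Z)}` — N0v's `familyPi_count_le` ∘ `fibredCount_le` BY NAME;
* §3 `count_components_geometry` — §2 with the member bound SUPPLIED from N0w's `memberSum_le_of_anchor` (`hinner`, the anchor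
  `hanchor`∕`hA`, the (2.36)-KIND `htransfer`, (1.26) `Gk.ineq126` BY NAME).
  «μ-FREE ∕ cutoff-free BY CONSTRUCTION» is thereby SYNTACTIC: the count is a theorem about the domain geometries and the rates, and
  the SAME theorem feeds both pencils below (R-t4r2-Q2: the constants precede `∀ μ`, `∀ K`).
* PART 2 (`DressedSmallFieldLabelCountsMu`, imports this file ONLY) fires N0s §3's `muPart_locE_le_of_coresAt_pencil_count` ONCE
  per index with `hCount` := §1 ∕ §2 ∕ §3 — road P1's source-pencil twins of N0u ∕ N0v ∕ N0w's ENDs (the table-pencil ENDs themselves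
  are `attachedPart_locE_le_of_coresAt_pencil_count` ∘ §1 ∕ §2 ∕ §3 — their proofs inline the same derivations; not re-filed).
Binder names VERBATIM N0u's ∕ N0v's ∕ N0w's, except that `0 ≤ Rkp` is a binder here (in the ENDs it follows from `hrate`).  DISJOINT from crew rows S40 (links SUPPLIED — `hlink` stays displayed here), S41 (N0u's count plugged
into N0w's `hinner` — displayed here), S44 (closure ∕ transfer ∕ anchor CONSTRUCTED on pv22's tori), W48 ∕ W50 ∕ W52 ∕ W53 (witnesses).

PRINTED LOCI (TYPE∕CONTEXT only — the audited manuscript [Balaban1988RGII] = CMP 116 (1988) 1–22, renders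
`b2b-balaban-ref1/pages/1988-cmp116-rg-II-cluster/…-p017∕p018∕p019∕p020-x2.png`; nothing below is used as a fact about Bałaban's
densities).  p. 17: «To get a bound for H(Z) we have to perform the resummation of the terms (2.14) over 𝐃, P and Z₀. We do it in
the following order. For a fixed Y₀ we sum over all 𝐃 satisfying (2.2). Next, we sum over Y₀, P determining a fixed Z₀. Further, for
a fixed Z′₀, we sum over all possible Z₀ determining this fixed Z′₀. Finally we sum over all Z′₀ ⊂ Z.»; p. 18 (2.27) «Σ_{Y∈𝐃}(d_k(Y)+5)
≥ d_k(Y₀)+5», (2.29); p. 19 «The exponential on the right-hand side multiplied by exp(−δκd_k(Z₀)) can be estimated by 1», (2.36)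
«2d_k(Z_i) ≥ Ld_{k+1}(Z′_i)», «A sum over n components is estimated by a product of n sums, each of them is a sum over independently
changing components»; p. 20 «the sum over all families of different localization domains Z′_i from 𝐃_{k+1}, satisfying ∪Z′_i = Z′₀,
is estimated using (2.29) … (2.27) is used for the remaining exponential factors».  §2 of [Balaban1988RGII] carries NO observable and
NO source: the μ-parts are the owner's extension (GAPS-T4 C-t4r2-340 (n1)), class NEW-UNPRINTED at small-field steps — which is
exactly why the count's independence of the table is worth a statement of its own.

WHAT THIS DOES TO THE WALL (owner's reading; nothing re-labelled).  (B3) = (B3-count) ∧ (B3-form) ∧ (B3-arith) (T4-DAG v45 Q47,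
«v1.8-proposed»): (B3-count) for the Y₀∕P-, {Z′_i}∕Z∖Z′₀- and component steps is now a NAMED, table-free kernel statement per step
(printed KIND; (2.29) PROVED by b13 BY NAME; links ∕ transfer ∕ anchor ∕ `hinner` DISPLAYED, of printed KIND, geometry only) — the
SAME statement for the dressed and the undressed run, for every source in the window and every cutoff.  (B3-form) (`hAmp`: the
letters' (2.15)∕(2.18)-form at the dressed radius) and (B1b) (`hadm`: the terms of `Z` ARE these labels) stay READING; (B3-arith)
is N0t's.  NOTHING of (B3) is discharged on Bałaban's densities; 0 binders instantiated on Bałaban's (2.14) data; wall v1.7 (T4-DAG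
v47) does NOT move; NE1′ NOT printed, NOT proved; 0∕9; count 9 unchanged.

HONEST FRAMING.  Finite combinatorics ∕ real arithmetic + by-name applications of N0u ∕ N0v ∕ N0w's count lemmas and b13's PROVED
(2.29) over `Geometry` HYPOTHESIS structures (an instance on pv22's torus is the crew's, S24∕S40∕S44 KIND; the identification of its
domains with Bałaban's 𝐃_k ∕ 𝐃_{k+1} is pv22's READING).  ABSOLUTE RULE honoured: the quotations above are LOCI of
the audited manuscript, TYPE∕CONTEXT only, never hypothesis-free facts; nothing internally minted is cited; [folklore]∕[arith] tags on
kernel lemmas only.  Rung (B)+1 on ONE finite T⁴ — NOT infinite volume, NOT a mass gap, NOT OS on ℝ⁴, NOT Clay.  HONEST DEPENDENCY: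
continuum YM on T⁴ ⇐ BetaPertH ∧ nine spine estimates (0/9 proved); BetaPertH ⇐ (D1) ∧ (D4) ∧ CAP+tail; G-an2-4 gates asym, D1 and
NE2/3/4. -/
noncomputable section

namespace Summit.QuantumFields.BalabanUV.T4Continuum.NE1p.DressedSmallFieldLabelCounts

open scoped BigOperators
open Literature.MathematicalPhysics.QuantumFieldTheory.Balaban1983to89 (LocDomainSys)
open Literature.MathematicalPhysics.QuantumFieldTheory.Balaban1983to89.B13FamilySum (coveringFamilies Ineq229
  ineq229_locDomainSys)
open Literature.MathematicalPhysics.QuantumFieldTheory.Balaban1983to89.B13Resummation (Geometry)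
open Summit.QuantumFields.BalabanUV.T4Continuum.NE1p.DressedSmallFieldFamilyCount (c₁_pos_of_geometry)
open Summit.QuantumFields.BalabanUV.T4Continuum.NE1p.DressedSmallFieldInnerCount (innerCount_le_decay)
open Summit.QuantumFields.BalabanUV.T4Continuum.NE1p.DressedSmallFieldOuterCount (fibredCount_le familyPi_count_le)
open Summit.QuantumFields.BalabanUV.T4Continuum.NE1p.DressedSmallFieldComponentCount (memberSum_le_of_anchor)

/-! ## §1 THE SECOND RESUMMATION STEP's COUNT, TABLE-FREE (N0u's `innerCount_le_decay` BY NAME + the rate bookkeeping) -/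

section InnerLabels

variable {D Dk : LocDomainSys} {CubeK : Type} [DecidableEq CubeK] {Bnd : Type} [DecidableEq Bnd]

/-- **THE INNER-LABEL COUNT OF A POLYMER, TABLE-FREE** (kernel; (2.27)∕(2.29)∕(2.31)–(2.34) KIND): for the labels `⟨W, (𝐃, P)⟩` of
the scale-`k` domain `Z₀ = foot Z` (`W ⊆ Gk.cubes (foot Z)` the uncovered cubes, `𝐃` a covering family of the rest, `P ⊆ bondsOf W`,
`#W ≤ 2·#P` — `hadm`), the table-blind majorants `(Π_{Y∈𝐃} α₆e^{−δκ d_k Y}·e^{−R(d_k Y+5)})·(s²t)^{#P}` of ANY sub-collection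
`terms Z` sum to `≤ e^{−Rkp·d(Z)}`, given: (2.29) from b13's `ineq229_locDomainSys` on `Gk` (`κ₀ + 1 ≤ δκ`, `e K₀ c₁ α₆ ≤ 1`), the
volume bound `Gk.volBound (foot Z)`, `hb₀`, the (2.27)∘(2.32)-KIND link `hlink` (displayed), the rates `0 ≤ Rkp ≤ R − c₁u` with
`u := e^{Rc₃₂}·s·e^{b₀t}` (whence `0 ≤ R`, `c₁u ≤ 5R`: the uncovered cubes' entropy costs the rate `c₁u`, the constant is paid by
print's `+5`) and `hmono : d(Z) ≤ d_k(foot Z)`.  NO table, pencil, source, core or carrier occurs in this statement. [folklore] -/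
theorem count_innerLabels_geometry (Gk : Geometry Dk CubeK) (foot : D.Dom → Dk.Dom) (hmono : ∀ Z, D.dj Z ≤ Dk.dj (foot Z))
    (bondsOf : Finset CubeK → Finset Bnd) {δ κ α₆ R Rkp c₃₂ b₀ s t : ℝ} (hα₆ : 0 ≤ α₆) (hκ : Gk.κ₀ + 1 ≤ δ * κ)
    (h229 : Real.exp 1 * Gk.K₀ * Gk.c₁ * α₆ ≤ 1) (hs0 : 0 ≤ s) (hs1 : s ≤ 1) (ht : 0 ≤ t)
    (hb₀ : ∀ W, ((bondsOf W).card : ℝ) ≤ b₀ * W.card) (hRkp : 0 ≤ Rkp)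
    (hRR : Rkp ≤ R - Gk.c₁ * (Real.exp (R * c₃₂) * s * Real.exp (b₀ * t)))
    (hlink : ∀ Z, ∀ W ⊆ Gk.cubes (foot Z), ∀ Df ∈ coveringFamilies Finset.univ Gk.cubes (Gk.cubes (foot Z) \ W),
      Dk.dj (foot Z) + 5 ≤ ∑ Y ∈ Df, (Dk.dj Y + 5) + c₃₂ * W.card)
    {terms : D.Dom → Finset (Σ _ : Finset CubeK, Finset Dk.Dom × Finset Bnd)}
    (hadm : ∀ Z, ∀ l ∈ terms Z, l.1 ⊆ Gk.cubes (foot Z) ∧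
      l.2.1 ∈ coveringFamilies Finset.univ Gk.cubes (Gk.cubes (foot Z) \ l.1) ∧ l.2.2 ⊆ bondsOf l.1 ∧ l.1.card ≤ 2 * l.2.2.card)
    (Z : D.Dom) :
    ∑ l ∈ terms Z, (∏ Y ∈ l.2.1, (α₆ * Real.exp (-(δ * κ * Dk.dj Y)) * Real.exp (-(R * (Dk.dj Y + 5))))) *
        (s ^ 2 * t) ^ l.2.2.card ≤ Real.exp (-(Rkp * D.dj Z)) := by
  set u := Real.exp (R * c₃₂) * s * Real.exp (b₀ * t) with hu
  have hc₁ : 0 < Gk.c₁ := c₁_pos_of_geometry Gk (foot Z)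
  -- rate bookkeeping: `0 ≤ R` and `c₁u ≤ 5R` FOLLOW from `0 ≤ Rkp ≤ R − c₁u`
  have hcu : 0 ≤ Gk.c₁ * u := mul_nonneg hc₁.le (by positivity)
  have hR : 0 ≤ R := by linarith
  have h229' : Ineq229 (Finset.univ : Finset Dk.Dom) Gk.cubes Dk.dj α₆ (δ * κ) :=
    ineq229_locDomainSys Dk Gk.cubes Gk.κ₀ Gk.K₀ Gk.c₁ δ κ α₆ 1 Gk.cubes_nonempty Gk.volBound Gk.ineq126 hα₆ zero_le_one hc₁ hκ
      (by linarith)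
  have hcount := innerCount_le_decay Finset.univ Gk.cubes Dk.dj bondsOf (Gk.cubes (foot Z)) (r := δ * κ) hα₆ hR hs0 hs1 ht
    (Gk.volBound (foot Z) (Finset.mem_univ _)) (fun W _ => hb₀ W) (fun Y₀ _ => h229' Y₀) (hlink Z) (hadm Z)
  refine hcount.trans ?_
  rw [← Real.exp_add]
  refine Real.exp_le_exp.2 ?_
  have hd : 0 ≤ D.dj Z := D.dj_nonneg Z
  have h1 : (R - Gk.c₁ * u) * D.dj Z ≤ (R - Gk.c₁ * u) * Dk.dj (foot Z) :=
    mul_le_mul_of_nonneg_left (hmono Z) (hRkp.trans hRR)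
  have h2 : Rkp * D.dj Z ≤ (R - Gk.c₁ * u) * D.dj Z := mul_le_mul_of_nonneg_right hRR hd
  have h3 : Gk.c₁ * u ≤ 5 * R := by linarith
  linarith

end InnerLabels

/-! ## §2 THE THIRD AND FOURTH RESUMMATION STEPS' COUNT, TABLE-FREE (N0v's `familyPi_count_le` ∘ `fibredCount_le` BY NAME) -/

section OuterLabels

variable {D : LocDomainSys} {Cube : Type} [DecidableEq Cube] {κ : D.Dom → Type}

/-- **THE OUTER-LABEL COUNT OF A POLYMER, TABLE-FREE** (kernel; (2.35)–(2.37)∕(2.39) KIND): for the labels `⟨W′, ⟨F, p⟩⟩` of the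
step-geometry polymer `Z` (`W′ ⊆ G.cubes Z` the cubes of `Z∖Z′₀`, `F` a covering family of `G.cubes Z ∖ W′` by scale-`(k+1)` domains
`Z′_i`, `p Z′ ∈ J Z′` an inner datum per member — `hadm`), the table-blind majorants `v^{#W′}·Π_{Z′∈F} n Z′ (p Z′)` of ANY
sub-collection `terms Z` sum to `≤ e^{−Rkp·d(Z)}`, given: the per-member inner bound `hmember` (`Σ_j n Z′ j ≤ a·e^{−r d(Z′)}·
e^{−R(d(Z′)+5)}` — displayed; WHERE N0u's inner count, the (2.36) transfer and the anchored component sum enter, §3), (2.29) AT SCALE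
`k+1` from b13's `ineq229_locDomainSys` on `G` (`G.κ₀ + 1 ≤ r`, `e·G.K₀·G.c₁·a ≤ 1`), `G.volBound Z`, the (2.27)∘(2.37)-KIND link
`hlink` (displayed; at `W′ = ∅` literally `G.ineq227 Z`) and the rates `0 ≤ Rkp ≤ R − c₁u`, `u := v·e^{Rc′}`.  NO table, pencil,
source, core or carrier occurs in this statement. [folklore] -/
theorem count_outerLabels_geometry (G : Geometry D Cube) (J : ∀ Z : D.Dom, Finset (κ Z)) (n : ∀ Z : D.Dom, κ Z → ℝ)
    (hn : ∀ Z j, 0 ≤ n Z j) {a r R Rkp c' v : ℝ} (ha : 0 ≤ a) (hv : 0 ≤ v)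
    (hκ : G.κ₀ + 1 ≤ r) (h229 : Real.exp 1 * G.K₀ * G.c₁ * a ≤ 1)
    (hmember : ∀ Z', ∑ j ∈ J Z', n Z' j ≤ a * Real.exp (-(r * D.dj Z')) * Real.exp (-(R * (D.dj Z' + 5))))
    (hlink : ∀ Z, ∀ W ⊆ G.cubes Z, ∀ F ∈ coveringFamilies Finset.univ G.cubes (G.cubes Z \ W),
      D.dj Z - c' * W.card + 5 ≤ ∑ Z' ∈ F, (D.dj Z' + 5))
    (hRkp : 0 ≤ Rkp) (hRR : Rkp ≤ R - G.c₁ * (v * Real.exp (R * c')))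
    {terms : D.Dom → Finset (Σ _ : Finset Cube, Σ F : Finset D.Dom, ∀ Z ∈ F, κ Z)}
    (hadm : ∀ Z, ∀ l ∈ terms Z, l.1 ⊆ G.cubes Z ∧
      l.2.1 ∈ coveringFamilies Finset.univ G.cubes (G.cubes Z \ l.1) ∧ ∀ Z' (h : Z' ∈ l.2.1), l.2.2 Z' h ∈ J Z')
    (Z : D.Dom) :
    ∑ l ∈ terms Z, v ^ l.1.card * ∏ x ∈ l.2.1.attach, n x.1 (l.2.2 x.1 x.2) ≤ Real.exp (-(Rkp * D.dj Z)) := by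
  classical
  have hc₁ : 0 < G.c₁ := c₁_pos_of_geometry G Z
  -- rate bookkeeping: `0 ≤ R` and `c₁u ≤ 5R` FOLLOW from `0 ≤ Rkp ≤ R − c₁u`
  have hcu : 0 ≤ G.c₁ * (v * Real.exp (R * c')) := mul_nonneg hc₁.le (by positivity)
  have hR : 0 ≤ R := by linarith
  have h229' : Ineq229 (Finset.univ : Finset D.Dom) G.cubes D.dj a (1 * r) :=
    ineq229_locDomainSys D G.cubes G.κ₀ G.K₀ G.c₁ 1 r a 1 G.cubes_nonempty G.volBound G.ineq126 ha zero_le_one hc₁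
      (by linarith) (by linarith)
  have h229r : ∀ Y₀ : Finset Cube,
      ∑ F ∈ coveringFamilies Finset.univ G.cubes Y₀, ∏ Z' ∈ F, a * Real.exp (-(r * D.dj Z')) ≤ 1 := fun Y₀ => by
    have h := h229' Y₀; rw [one_mul] at h; exact h
  -- step three per fibre `W′`: the families `{Z′_i}` with inner data (N0v §2), then step four over `W′ ⊆ G.cubes Z` (N0v §1)
  have hfib : ∀ W ⊆ G.cubes Z,
      ∑ i ∈ (coveringFamilies Finset.univ G.cubes (G.cubes Z \ W)).sigma (fun F => F.pi J),
        (∏ x ∈ i.1.attach, n x.1 (i.2 x.1 x.2)) ≤ Real.exp (-(R * (D.dj Z - c' * W.card + 5))) :=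
    fun W hW => familyPi_count_le Finset.univ G.cubes D.dj (G.cubes Z \ W) J n hn ha hR (fun Z' _ => hmember Z')
      (h229r _) (hlink Z W hW) fun l hl => Finset.mem_sigma.1 hl
  have hcount := fibredCount_le (G.cubes Z)
    (fun W => (coveringFamilies Finset.univ G.cubes (G.cubes Z \ W)).sigma fun F => F.pi J)
    (fun _ i => ∏ x ∈ i.1.attach, n x.1 (i.2 x.1 x.2)) hv (fun _ i => Finset.prod_nonneg fun x _ => hn _ _) hfib
    (terms := terms Z) fun l hl => ⟨(hadm Z l hl).1, Finset.mem_sigma.2 ⟨(hadm Z l hl).2.1, Finset.mem_pi.2 (hadm Z l hl).2.2⟩⟩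
  refine hcount.trans ?_
  have hvol := G.volBound Z (Finset.mem_univ Z)
  have hu0 : 0 ≤ v * Real.exp (R * c') := by positivity
  rw [← Real.exp_add]
  refine Real.exp_le_exp.2 ?_
  have hd : 0 ≤ D.dj Z := D.dj_nonneg Z
  have h2 : Rkp * D.dj Z ≤ (R - G.c₁ * (v * Real.exp (R * c'))) * D.dj Z := mul_le_mul_of_nonneg_right hRR hd
  have h3 : ((G.cubes Z).card : ℝ) * (v * Real.exp (R * c')) ≤ G.c₁ * (1 + D.dj Z) * (v * Real.exp (R * c')) :=
    mul_le_mul_of_nonneg_right hvol hu0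
  have h4 : G.c₁ * (v * Real.exp (R * c')) ≤ 5 * R := by linarith
  nlinarith

end OuterLabels

/-! ## §3 THE COMPONENT STEP's COUNT, TABLE-FREE (§2 with `hmember` SUPPLIED by N0w's `memberSum_le_of_anchor`) -/

section Components

variable {D Dk : LocDomainSys} {Cube : Type} [DecidableEq Cube] {CubeK : Type} [DecidableEq CubeK] {ι₀ : Type}

open Classical in
/-- **THE OUTER-LABEL COUNT WITH ANCHORED COMPONENTS AS INNER DATA, TABLE-FREE** (kernel; p. 19–20 KIND): §2 at the inner data
`κ Z′ := Σ _ : Dk.Dom, ι₀` (a scale-`k` component `Z₀` with `cl Z₀ = Z′` and one of its inner labels `l ∈ I Z₀`), inner finsets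
`(univ.filter (cl · = Z′)).sigma I`, weights `ε·m Z₀ l`, with `hmember` SUPPLIED by N0w's `memberSum_le_of_anchor` from the displayed
`hinner` (N0u's currency `Σ_l m Z₀ l ≤ e^{c₀}e^{−R₀ d_k Z₀}`), the anchor `hanchor`∕`hA`, the (2.36)-KIND `htransfer`, (1.26)
`Gk.ineq126` BY NAME and the rates `Gk.κ₀ ≤ R₀`, `r + R ≤ (R₀ − Gk.κ₀)·ℓ`; amplitude `a := ε·e^{c₀}·Aₐ·Gk.K₀·e^{5R}` in (2.29)'s
clause.  NO table, pencil, source, core or carrier occurs in this statement. [folklore] -/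
theorem count_components_geometry (G : Geometry D Cube) (Gk : Geometry Dk CubeK) (I : Dk.Dom → Finset ι₀)
    (m : Dk.Dom → ι₀ → ℝ) (hm0 : ∀ Z₀ l, 0 ≤ m Z₀ l) (cl : Dk.Dom → D.Dom) (anc : D.Dom → Finset CubeK)
    {ε c₀ R₀ Aₐ ℓ r R Rkp c' v : ℝ} (hε : 0 ≤ ε) (hv : 0 ≤ v)
    (hinner : ∀ Z₀, ∑ l ∈ I Z₀, m Z₀ l ≤ Real.exp c₀ * Real.exp (-(R₀ * Dk.dj Z₀)))
    (hanchor : ∀ Z₀ Z', cl Z₀ = Z' → ∃ c ∈ anc Z', c ∈ Gk.cubes Z₀) (hA : ∀ Z', ((anc Z').card : ℝ) ≤ Aₐ)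
    (htransfer : ∀ Z₀ Z', cl Z₀ = Z' → ℓ * D.dj Z' ≤ Dk.dj Z₀) (hκR : Gk.κ₀ ≤ R₀) (hrate2 : r + R ≤ (R₀ - Gk.κ₀) * ℓ)
    (hκ : G.κ₀ + 1 ≤ r) (h229 : Real.exp 1 * G.K₀ * G.c₁ * (ε * Real.exp c₀ * Aₐ * Gk.K₀ * Real.exp (5 * R)) ≤ 1)
    (hlink : ∀ Z, ∀ W ⊆ G.cubes Z, ∀ F ∈ coveringFamilies Finset.univ G.cubes (G.cubes Z \ W),
      D.dj Z - c' * W.card + 5 ≤ ∑ Z' ∈ F, (D.dj Z' + 5))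
    (hRkp : 0 ≤ Rkp) (hRR : Rkp ≤ R - G.c₁ * (v * Real.exp (R * c')))
    {terms : D.Dom → Finset (Σ _ : Finset Cube, Σ F : Finset D.Dom, ∀ Z ∈ F, (Σ _ : Dk.Dom, ι₀))}
    (hadm : ∀ Z, ∀ l ∈ terms Z, l.1 ⊆ G.cubes Z ∧
      l.2.1 ∈ coveringFamilies Finset.univ G.cubes (G.cubes Z \ l.1) ∧
      ∀ Z' (h : Z' ∈ l.2.1), l.2.2 Z' h ∈ ((Finset.univ : Finset Dk.Dom).filter (fun Z₀ => cl Z₀ = Z')).sigma I)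
    (Z : D.Dom) :
    ∑ l ∈ terms Z, v ^ l.1.card * ∏ x ∈ l.2.1.attach, (ε * m (l.2.2 x.1 x.2).1 (l.2.2 x.1 x.2).2) ≤
      Real.exp (-(Rkp * D.dj Z)) :=
  have hA0 : (0 : ℝ) ≤ Aₐ := le_trans (Nat.cast_nonneg _) (hA Z)
  have ha : 0 ≤ ε * Real.exp c₀ * Aₐ * Gk.K₀ * Real.exp (5 * R) :=
    mul_nonneg (mul_nonneg (mul_nonneg (mul_nonneg hε (Real.exp_pos _).le) hA0) Gk.K₀_nonneg) (Real.exp_pos _).le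
  count_outerLabels_geometry G (fun Z' => ((Finset.univ : Finset Dk.Dom).filter (fun Z₀ => cl Z₀ = Z')).sigma I)
    (fun _ j => ε * m j.1 j.2) (fun _ _ => mul_nonneg hε (hm0 _ _)) ha hv hκ h229
    (fun Z' => memberSum_le_of_anchor Finset.univ Gk.cubes Dk.dj cl anc D.dj I m hε Gk.K₀_nonneg Z' (D.dj_nonneg Z')
      (fun Z₀ _ => hinner Z₀) (fun c _ => Gk.ineq126 c) (fun Z₀ _ h => hanchor Z₀ Z' h) (hA Z')
      (fun Z₀ _ h => htransfer Z₀ Z' h) hκR hrate2)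
    hlink hRkp hRR hadm Z

end Components

end Summit.QuantumFields.BalabanUV.T4Continuum.NE1p.DressedSmallFieldLabelCounts

end
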